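import Literature.Geometry.Riemannian.CurvatureDerivativeNormSq
import Literature.Geometry.Riemannian.RicciFlowShiEstimates
import Literature.Geometry.Riemannian.CurvatureNormSq
import Mathlib.Analysis.SpecialFunctions.Pow.Real
import HarnessLib

/-!
# Decay of the higher curvature derivatives of a round Type-I Ricci flow: the induction step
(helper `helper_curvDeriv_decay_step` for layer S3c `helper_curvDeriv_decay_all` of stub
`stub_smoothRoundLimit`, line `margerin-cone-hamilton-rails`, crux `EntropyRung.ChangGurskyYang`,
item stmt-SmoothPoincare4-10834)

Hamilton 1982, §17, Thm. 17.6 (with Shi's estimates in maximum-principle form), ONE induction step: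
along a Ricci flow of Riemannian metrics `g(t)` on `[0, T)` on a closed 4-manifold, write
`U_k = |∇ᵏRm|²` (`curvDerivNormSq`), `h = T − t`. GIVEN the Bernstein window lemma for pairs of
evolution inequalities `∂ₜf ≤ Δf − θF + Φf`, `∂ₜF ≤ ΔF + ΦF` (hypothesis; the registered neighbour
`helper_bernsteinWindow`), the scaled Shi bounds `U_p ≤ S h^{−p−2}` for `p ≤ n + 2` and the decay
`U_{j+1} ≤ D h^{δ−j−3}` for `j ≤ n` at late times, one gets `U_{n+2} ≤ C' h^{δ/2−n−4}` at late
times (`helper_curvDeriv_decay_step`).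

Proof. The evolution inequalities (Topping 2006, (3.3.4); tree theorem
`IsRicciFlow.derivWithin_curvDerivNormSq_le`) for `f = U_{n+1}`, `F = U_{n+2}` have `θ = 2` and
reaction terms `Φf ≤ A h^{δ/2−n−4}`, `ΦF ≤ 3C₂S h⁻¹ F + B h^{δ/2−n−5}` (`decayAll_phi_f_bound`,
`decayAll_phi_F_bound`: every product `√U_p √U_q √U_r` contains a decaying factor, except the
terms `√U_0 U_{n+2} ≤ √S h⁻¹ U_{n+2}` absorbed into `K = 6C₂S/h₁`). On the window
`[t₁, t₁ + κh₁]`, `h₁ = T − t₁ ≤ 1`, `κ ≤ 1/2`, `6C₂Sκ ≤ 1`, the window lemma gives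
`κh₁ U_{n+2}(t₁ + κh₁) ≤ D h₁^{δ−n−3} + κh₁(κh₁ b + a)`, whence `U_{n+2} ≤ C' h^{δ/2−n−4}` at
`t = t₁ + κh₁` (`decayAll_window_arith`; powers of `h₁ ∈ [h, 2h]` and `h` compare up to `2^{|e|}`,
`decayAll_rpow_window_le`); every late `t` is of this form.

## References

* R. S. Hamilton, *Three-manifolds with positive Ricci curvature*, J. Differential Geom. 17
  (1982) 255–306, §13 (Thm. 13.4 ff.), §17, Thm. 17.6. [Hamilton1982]
* P. Topping, *Lectures on the Ricci flow*, LMS Lecture Note Series 325, CUP 2006, §3.3: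
  Thm. 3.3.1 with its proof, (3.3.4) (pp. 37–39). [Topping2006]
-/

noncomputable section

-- every `Summit.SmoothPoincare4.SmoothPoincare4.…` name repeats the summit = sub-problem segment (D-0017 layout)
set_option linter.dupNamespace false

open Set Function Filter
open scoped Manifold ContDiff Topology

namespace Summit.SmoothPoincare4.SmoothPoincare4.Theorems.MargerinRails

open Literature.Geometry.Riemannian
open Literature.Geometry.Lorentzian Literature.Geometry.Lorentzian.PseudoRiemannianMetric

/-! ### Real-variable lemmas -/

section RealLemmas

/-- Powers of comparable lengths compare: `h/2 ≤ h' ≤ 2h` and `2^{|e|} ≤ P` give `h'^e ≤ P h^e`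
(the bookkeeping between `h = T − t` and `h₁ = T − t₁` on a window). [folklore] -/
theorem decayAll_rpow_window_le {h h' P : ℝ} (e : ℝ) (hh : 0 < h) (h1 : h / 2 ≤ h')
    (h2 : h' ≤ 2 * h) (hP : 2 ^ |e| ≤ P) : h' ^ e ≤ P * h ^ e := by
  have hh' : 0 < h' := by linarith
  refine le_trans ?_ (mul_le_mul_of_nonneg_right hP (Real.rpow_nonneg hh.le _))
  rcases le_or_gt 0 e with he | he
  · rw [abs_of_nonneg he, ← Real.mul_rpow zero_le_two hh.le]
    exact Real.rpow_le_rpow hh'.le h2 he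
  · rw [abs_of_neg he, Real.rpow_neg zero_le_two, ← Real.inv_rpow zero_le_two,
      ← Real.mul_rpow (inv_nonneg.2 zero_le_two) hh.le, show (2 : ℝ)⁻¹ * h = h / 2 by ring]
    exact Real.rpow_le_rpow_of_nonpos (by positivity) h1 he.le

/-- `u ≤ A h^e` with `A ≥ 1` gives `√u ≤ A h^{e/2}`. [folklore] -/
theorem decayAll_sqrt_le {u A h e : ℝ} (hh : 0 < h) (hA : 1 ≤ A) (hu : u ≤ A * h ^ e) :
    Real.sqrt u ≤ A * h ^ (e / 2) := by
  have hA0 : 0 ≤ A := zero_le_one.trans hA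
  calc Real.sqrt u ≤ Real.sqrt (A * h ^ e) := Real.sqrt_le_sqrt hu
    _ = Real.sqrt A * h ^ (e / 2) := by
      rw [Real.sqrt_mul hA0, Real.sqrt_eq_rpow (h ^ e), ← Real.rpow_mul hh.le,
        show e * (1 / 2) = e / 2 by ring]
    _ ≤ A * h ^ (e / 2) := by
      refine mul_le_mul_of_nonneg_right ?_ (Real.rpow_nonneg hh.le _)
      rw [Real.sqrt_le_left hA0]
      nlinarith

/-- Products of power bounds: `x ≤ A h^a`, `0 ≤ y ≤ B h^b`, `A ≥ 0` give `xy ≤ AB h^{a+b}`.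
[folklore] -/
theorem decayAll_mul_le {x y A B a b h : ℝ} (hh : 0 < h) (hx : x ≤ A * h ^ a) (hy : y ≤ B * h ^ b)
    (hy0 : 0 ≤ y) (hA : 0 ≤ A) : x * y ≤ A * B * h ^ (a + b) := by
  calc x * y ≤ (A * h ^ a) * (B * h ^ b) :=
        mul_le_mul hx hy hy0 (mul_nonneg hA (Real.rpow_nonneg hh.le _))
    _ = A * B * h ^ (a + b) := by rw [Real.rpow_add hh]; ring

/-- **The reaction term of the evolution inequality for `U_{n+1}` decays** (Hamilton 1982, §17,
proof of Thm. 17.6): with the Shi bounds `u_p ≤ S h^{−p−2}` (`p ≤ n + 2`, `S ≥ 1`) and the decay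
`u_{j+1} ≤ D h^{δ−j−3}` (`j ≤ n`, `D ≥ 1`, `0 < h ≤ 1`),
`C (Σ_{p ≤ n+1} √u_p √u_{n+1−p}) √u_{n+1} + C √u_0 u_{n+1} ≤ C((n+2)S²D + SD) h^{δ/2−n−4}`.
[cite: Hamilton1982, §17, Thm. 17.6] [cite: Topping2006, Thm. 3.3.1] -/
theorem decayAll_phi_f_bound {n : ℕ} {u : ℕ → ℝ} {h S D δ C : ℝ} (hh : 0 < h) (hh1 : h ≤ 1)
    (hS : 1 ≤ S) (hD : 1 ≤ D) (hδ : 0 < δ) (hu0 : ∀ p, 0 ≤ u p)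
    (huS : ∀ p ≤ n + 1 + 1, u p ≤ S * h ^ (-(p : ℝ) - 2))
    (huD : ∀ j ≤ n, u (j + 1) ≤ D * h ^ (δ - j - 3)) (hC : 0 ≤ C) :
    C * (∑ p ∈ Finset.range (n + 1 + 1), Real.sqrt (u p) * Real.sqrt (u (n + 1 - p))) *
        Real.sqrt (u (n + 1)) + C * Real.sqrt (u 0) * u (n + 1) ≤
      C * ((n + 2) * S ^ 2 * D + S * D) * h ^ (δ / 2 - n - 4) := by
  have hS0 : 0 ≤ S := zero_le_one.trans hS
  have hr : ∀ p ≤ n + 1 + 1, Real.sqrt (u p) ≤ S * h ^ ((-(p : ℝ) - 2) / 2) := fun p hp ↦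
    decayAll_sqrt_le hh hS (huS p hp)
  have hsum : ∑ p ∈ Finset.range (n + 1 + 1), Real.sqrt (u p) * Real.sqrt (u (n + 1 - p)) ≤
      (n + 2) * S ^ 2 * h ^ ((-(n : ℝ) - 5) / 2) := by
    have hterm : ∀ p ∈ Finset.range (n + 1 + 1),
        Real.sqrt (u p) * Real.sqrt (u (n + 1 - p)) ≤ S * S * h ^ ((-(n : ℝ) - 5) / 2) := by
      intro p hp
      have hp' : p ≤ n + 1 := Nat.lt_succ_iff.mp (Finset.mem_range.mp hp)
      have h2 := hr (n + 1 - p) (by omega)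
      rw [Nat.cast_sub hp'] at h2
      refine (decayAll_mul_le hh (hr p (by omega)) h2 (Real.sqrt_nonneg _) hS0).trans_eq ?_
      congr 2
      push_cast
      ring
    refine (Finset.sum_le_card_nsmul _ _ _ hterm).trans_eq ?_
    rw [Finset.card_range, nsmul_eq_mul]
    push_cast
    ring
  have hlast : Real.sqrt (u (n + 1)) ≤ D * h ^ ((δ - n - 3) / 2) :=
    decayAll_sqrt_le hh hD (huD n le_rfl)
  have e1 : (∑ p ∈ Finset.range (n + 1 + 1), Real.sqrt (u p) * Real.sqrt (u (n + 1 - p))) *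
      Real.sqrt (u (n + 1)) ≤ (n + 2) * S ^ 2 * D * h ^ (δ / 2 - n - 4) := by
    refine (decayAll_mul_le hh hsum hlast (Real.sqrt_nonneg _) (by positivity)).trans_eq ?_
    congr 2
    ring
  have e2 : Real.sqrt (u 0) * u (n + 1) ≤ S * D * h ^ (δ / 2 - n - 4) := by
    refine (decayAll_mul_le hh (hr 0 (Nat.zero_le _)) (huD n le_rfl) (hu0 _) hS0).trans ?_
    refine mul_le_mul_of_nonneg_left (Real.rpow_le_rpow_of_exponent_ge hh hh1 ?_) (by positivity)
    push_cast
    linarith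
  calc C * (∑ p ∈ Finset.range (n + 1 + 1), Real.sqrt (u p) * Real.sqrt (u (n + 1 - p))) *
          Real.sqrt (u (n + 1)) + C * Real.sqrt (u 0) * u (n + 1)
      = C * ((∑ p ∈ Finset.range (n + 1 + 1), Real.sqrt (u p) * Real.sqrt (u (n + 1 - p))) *
          Real.sqrt (u (n + 1))) + C * (Real.sqrt (u 0) * u (n + 1)) := by ring
    _ ≤ C * ((n + 2) * S ^ 2 * D * h ^ (δ / 2 - n - 4)) + C * (S * D * h ^ (δ / 2 - n - 4)) :=
      add_le_add (mul_le_mul_of_nonneg_left e1 hC) (mul_le_mul_of_nonneg_left e2 hC)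
    _ = C * ((n + 2) * S ^ 2 * D + S * D) * h ^ (δ / 2 - n - 4) := by ring

/-- **The reaction term of the evolution inequality for `U_{n+2}` is `≤ K U_{n+2} + b`** (Hamilton
1982, §17, proof of Thm. 17.6): with the Shi bounds (`p ≤ n + 2`) and the decay (`j ≤ n`), the end
terms `p = 0`, `p = n + 2` of the sum and the extra term give `3C √u_0 u_{n+2} ≤ 3CS h⁻¹ u_{n+2}`,
the middle terms `C(n+1)DS² h^{δ/2−n−5}`, and `−2u_{n+3} ≤ 0`.
[cite: Hamilton1982, §17, Thm. 17.6] [cite: Topping2006, Thm. 3.3.1] -/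
theorem decayAll_phi_F_bound {n : ℕ} {u : ℕ → ℝ} {h S D δ C : ℝ} (hh : 0 < h)
    (hS : 1 ≤ S) (hD : 1 ≤ D) (hu0 : ∀ p, 0 ≤ u p)
    (huS : ∀ p ≤ n + 1 + 1, u p ≤ S * h ^ (-(p : ℝ) - 2))
    (huD : ∀ j ≤ n, u (j + 1) ≤ D * h ^ (δ - j - 3)) (hC : 0 ≤ C) :
    -2 * u (n + 1 + 1 + 1) + C * (∑ p ∈ Finset.range (n + 1 + 1 + 1), Real.sqrt (u p) *
        Real.sqrt (u (n + 1 + 1 - p))) * Real.sqrt (u (n + 1 + 1)) +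
        C * Real.sqrt (u 0) * u (n + 1 + 1) ≤
      3 * C * S * (h ^ (-1 : ℝ) * u (n + 1 + 1)) +
        C * ((n + 1) * D * S ^ 2) * h ^ (δ / 2 - n - 5) := by
  have hS0 : 0 ≤ S := zero_le_one.trans hS
  have hD0 : 0 ≤ D := zero_le_one.trans hD
  have hr : ∀ p ≤ n + 1 + 1, Real.sqrt (u p) ≤ S * h ^ ((-(p : ℝ) - 2) / 2) := fun p hp ↦
    decayAll_sqrt_le hh hS (huS p hp)
  have hrD : ∀ j ≤ n, Real.sqrt (u (j + 1)) ≤ D * h ^ ((δ - j - 3) / 2) := fun j hj ↦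
    decayAll_sqrt_le hh hD (huD j hj)
  have hv0 : 0 ≤ Real.sqrt (u (n + 1 + 1)) := Real.sqrt_nonneg _
  have hvv : Real.sqrt (u (n + 1 + 1)) * Real.sqrt (u (n + 1 + 1)) = u (n + 1 + 1) :=
    Real.mul_self_sqrt (hu0 _)
  have hvS : Real.sqrt (u (n + 1 + 1)) ≤ S * h ^ ((-(n : ℝ) - 4) / 2) := by
    refine (hr (n + 1 + 1) le_rfl).trans_eq ?_
    congr 2
    push_cast
    ring
  have h0 : Real.sqrt (u 0) ≤ S * h ^ (-1 : ℝ) := by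
    refine (hr 0 (Nat.zero_le _)).trans_eq ?_
    congr 2
    push_cast
    ring
  -- the middle terms of the sum
  have hmid : ∑ p ∈ Finset.range (n + 1),
      Real.sqrt (u (p + 1)) * Real.sqrt (u (n + 1 + 1 - (p + 1))) ≤
      (n + 1) * (D * S) * h ^ ((δ - n - 6) / 2) := by
    have hterm : ∀ p ∈ Finset.range (n + 1),
        Real.sqrt (u (p + 1)) * Real.sqrt (u (n + 1 + 1 - (p + 1))) ≤
          D * S * h ^ ((δ - n - 6) / 2) := by
      intro p hp
      have hp' : p ≤ n := Nat.lt_succ_iff.mp (Finset.mem_range.mp hp)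
      have h2 := hr (n + 1 + 1 - (p + 1)) (by omega)
      rw [Nat.cast_sub (by omega : p + 1 ≤ n + 1 + 1)] at h2
      refine (decayAll_mul_le hh (hrD p hp') h2 (Real.sqrt_nonneg _) hD0).trans_eq ?_
      congr 2
      push_cast
      ring
    refine (Finset.sum_le_card_nsmul _ _ _ hterm).trans_eq ?_
    rw [Finset.card_range, nsmul_eq_mul]
    push_cast
    ring
  have e1 : (∑ p ∈ Finset.range (n + 1),
      Real.sqrt (u (p + 1)) * Real.sqrt (u (n + 1 + 1 - (p + 1)))) * Real.sqrt (u (n + 1 + 1)) ≤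
      (n + 1) * (D * S) * S * h ^ (δ / 2 - n - 5) := by
    refine (decayAll_mul_le hh hmid hvS hv0 (by positivity)).trans_eq ?_
    congr 2
    ring
  have e2 : Real.sqrt (u 0) * u (n + 1 + 1) ≤ S * h ^ (-1 : ℝ) * u (n + 1 + 1) :=
    mul_le_mul_of_nonneg_right h0 (hu0 _)
  have e3 := hu0 (n + 1 + 1 + 1)
  rw [Finset.sum_range_succ, Finset.sum_range_succ', Nat.sub_zero, Nat.sub_self]
  have hsplit : C * (∑ p ∈ Finset.range (n + 1),
      Real.sqrt (u (p + 1)) * Real.sqrt (u (n + 1 + 1 - (p + 1))) +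
      Real.sqrt (u 0) * Real.sqrt (u (n + 1 + 1)) + Real.sqrt (u (n + 1 + 1)) * Real.sqrt (u 0)) *
      Real.sqrt (u (n + 1 + 1)) =
      C * ((∑ p ∈ Finset.range (n + 1),
        Real.sqrt (u (p + 1)) * Real.sqrt (u (n + 1 + 1 - (p + 1)))) * Real.sqrt (u (n + 1 + 1))) +
        2 * C * (Real.sqrt (u 0) * u (n + 1 + 1)) := by
    linear_combination (2 * C * Real.sqrt (u 0)) * hvv
  rw [hsplit]
  linarith [mul_le_mul_of_nonneg_left e1 hC, mul_le_mul_of_nonneg_left e2 hC]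

/-- **The arithmetic of the window lemma at `t = t₁ + κh₁`**: from
`κh₁ u ≤ D₁ h₁^{d+1} + κh₁ (κh₁ · BP h₁^{e−1} + AP h₁^e)` with `h ≤ h₁ ≤ 2h`, `h₁ ≤ 1`, `e ≤ d`,
`2^{|e|} ≤ P`: `u ≤ (D₁/κ + κBP + AP) P h^e`. [cite: Hamilton1982, §17, Thm. 17.6] -/
theorem decayAll_window_arith {κ h h₁ D₁ B A P u d₀ d e eF : ℝ} (hκ : 0 < κ) (hh : 0 < h)
    (hhh₁ : h ≤ h₁) (hh₁2 : h₁ ≤ 2 * h) (hh₁1 : h₁ ≤ 1) (hD : 0 ≤ D₁) (hB : 0 ≤ B) (hA : 0 ≤ A)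
    (hP : 2 ^ |e| ≤ P) (hd₀ : d₀ = d + 1) (heF : e = eF + 1) (hed : e ≤ d)
    (hkey : κ * h₁ * u ≤ 2 / 2 * (D₁ * h₁ ^ d₀) +
      κ * h₁ * (κ * h₁ * (B * P * h₁ ^ eF) + 2 * (A * P * h₁ ^ e) / 2)) :
    u ≤ (D₁ * κ⁻¹ + κ * (B * P) + A * P) * P * h ^ e := by
  have hh₁ : 0 < h₁ := hh.trans_le hhh₁
  have hP0 : 0 ≤ P := (Real.rpow_nonneg zero_le_two _).trans hP
  have hpow1 : h₁ ^ d₀ = h₁ ^ d * h₁ := by rw [hd₀, Real.rpow_add_one hh₁.ne']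
  have hpow2 : h₁ ^ d ≤ h₁ ^ e := Real.rpow_le_rpow_of_exponent_ge hh₁ hh₁1 hed
  have hpow3 : h₁ * h₁ ^ eF = h₁ ^ e := by rw [heF, Real.rpow_add_one hh₁.ne', mul_comm]
  have hw : h₁ ^ e ≤ P * h ^ e := decayAll_rpow_window_le e hh (by linarith) hh₁2 hP
  -- divide the window inequality by `τ = κ h₁`
  have k' : κ * h₁ * u ≤
      κ * h₁ * (D₁ * κ⁻¹ * h₁ ^ d + (κ * (B * P) * (h₁ * h₁ ^ eF) + A * P * h₁ ^ e)) := by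
    have e1 : 2 / 2 * (D₁ * h₁ ^ d₀) = κ * h₁ * (D₁ * κ⁻¹ * h₁ ^ d) := by
      rw [hpow1, show κ * h₁ * (D₁ * κ⁻¹ * h₁ ^ d) = κ * κ⁻¹ * (D₁ * (h₁ ^ d * h₁)) by ring,
        mul_inv_cancel₀ hκ.ne']
      ring
    rw [e1] at hkey
    linarith
  have k'' := le_of_mul_le_mul_left k' (mul_pos hκ hh₁)
  rw [hpow3] at k''
  have hsum : D₁ * κ⁻¹ * h₁ ^ d + (κ * (B * P) * h₁ ^ e + A * P * h₁ ^ e) ≤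
      (D₁ * κ⁻¹ + κ * (B * P) + A * P) * h₁ ^ e := by
    have := mul_le_mul_of_nonneg_left hpow2 (mul_nonneg hD (inv_nonneg.2 hκ.le))
    linarith
  calc u ≤ _ := k''.trans hsum
    _ ≤ (D₁ * κ⁻¹ + κ * (B * P) + A * P) * (P * h ^ e) :=
      mul_le_mul_of_nonneg_left hw (by positivity)
    _ = _ := by ring

end RealLemmas

/-! ### The induction step along the flow -/

/-- **HELPER — THE INDUCTION STEP OF Hamilton 1982, Thm. 17.6 (decay of `|∇^{n+2}Rm|²` from the
decay of `|∇Rm|², …, |∇^{n+1}Rm|²`).** Along a Ricci flow of Riemannian metrics on `[0, T)` on a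
closed 4-manifold, GIVEN the Bernstein window lemma, the scaled Shi bounds
`U_p ≤ S (T−t)^{−p−2}` (`p ≤ n + 2`, `S ≥ 1`) on `[t_S, T)` and the decay
`U_{j+1} ≤ D (T−t)^{δ−j−3}` (`j ≤ n`, `δ > 0`) on `[t_D, T)`: `U_{n+2} ≤ C' (T−t)^{δ/2−n−4}` on some
`[t', T)`. The window lemma with `θ = 2`, `f = U_{n+1}`, `F = U_{n+2}` (evolution inequalities
`IsRicciFlow.derivWithin_curvDerivNormSq_le`, joint smoothness
`IsRicciFlow.contMDiffOn_curvDerivNormSq`) on `[t₁, t₁ + κh₁]`, `h₁ = T − t₁ = (T − t)/(1 − κ)`,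
`κ = min(1/2, 1/(6C₂S + 1))`, `K = 6C₂S/h₁`, `A₀ = D₁ h₁^{δ−n−3}`, with the reaction bounds
`decayAll_phi_f_bound`, `decayAll_phi_F_bound` and the arithmetic `decayAll_window_arith`.
[cite: Hamilton1982, §17, Thm. 17.6] [cite: Topping2006, Thm. 3.3.1] -/
theorem helper_curvDeriv_decay_step : ∀ (M : Type) [TopologicalSpace M] [T2Space M] [SecondCountableTopology M] [ChartedSpace (EuclideanSpace ℝ (Fin 4)) M] [IsManifold (𝓡 4) ∞ M] [CompactSpace M] (g : ℝ → PseudoRiemannianMetric (𝓡 4) ∞ (EuclideanSpace ℝ (Fin 4)) (TangentSpace (𝓡 4) : M → Type _)) (cov : ℝ → CovariantDerivative (𝓡 4) (EuclideanSpace ℝ (Fin 4)) (TangentSpace (𝓡 4) : M → Type _)) (T : ℝ), 0 < T → IsRicciFlow g cov (Ico 0 T) → (∀ t ∈ Ico 0 T, (g t).IsRiemannian) → (∀ (θ : ℝ) (f F Φf ΦF : ℝ → M → ℝ), 0 < θ → ContMDiffOn ((𝓡 4).prod 𝓘(ℝ, ℝ)) 𝓘(ℝ, ℝ) ∞ (fun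 p : M × ℝ ↦ f p.2 p.1) (univ ×ˢ Ico 0 T) → ContMDiffOn ((𝓡 4).prod 𝓘(ℝ, ℝ)) 𝓘(ℝ, ℝ) ∞ (fun p : M × ℝ ↦ F p.2 p.1) (univ ×ˢ Ico 0 T) → (∀ t ∈ Ico 0 T, ∀ x : M, 0 ≤ f t x) → (∀ t ∈ Ico 0 T, ∀ x : M, 0 ≤ F t x) → (∀ t ∈ Ico 0 T, ∀ x : M, derivWithin (fun s ↦ f s x) (Ico 0 T) t ≤ (g t).laplaceBeltrami (f t) x - θ * F t x + Φf t x) → (∀ t ∈ Ico 0 T, ∀ x : M, derivWithin (fun s ↦ F s x) (Ico 0 T) t ≤ (g t).laplaceBeltrami (F t) x + ΦF t x) → ∀ (t₁ τ K a b A₀ : ℝ), t₁ ∈ Ico 0 T → 0 < τ → t₁ + τ < T → 0 ≤ K → 0 ≤ a → 0 ≤ b → K * τ ≤ 1 → (∀ x : M, f t₁ x ≤ A₀) → (∀ t ∈ Icc t₁ (t₁ + τ), ∀ x : M, Φf t x ≤ a) → (∀ t ∈ Icc t₁ (t₁ + τ), ∀ x : M, ΦF t x ≤ K * F t x + b) →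 ∀ t ∈ Icc t₁ (t₁ + τ), ∀ x : M, (t - t₁) * F t x ≤ 2 / θ * A₀ + τ * (τ * b + 2 * a / θ)) → ∀ (n : ℕ) (S tS δ D tD : ℝ), 1 ≤ S → tS ∈ Ico 0 T → (∀ p ≤ n + 2, ∀ t ∈ Ico tS T, ∀ z : M, curvDerivNormSq (𝓡 4) g p t z ≤ S * (T - t) ^ (-(p : ℝ) - 2)) → 0 < δ → tD ∈ Ico 0 T → (∀ j ≤ n, ∀ t ∈ Ico tD T, ∀ x : M, curvDerivNormSq (𝓡 4) g (j + 1) t x ≤ D * (T - t) ^ (δ - j - 3)) → ∃ C' t' : ℝ, t' ∈ Ico 0 T ∧ ∀ t ∈ Ico t' T, ∀ x : M, curvDerivNormSq (𝓡 4) g (n + 2) t x ≤ C' * (T - t) ^ (δ / 2 - n - 4) := by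
  intro M _ _ _ _ _ _ g cov T hT hflow hR hW n S tS δ D tD hS1 htS hShi hδ htD hDec
  have hS : UniqueDiffOn ℝ (Ico 0 T) := uniqueDiffOn_Ico 0 T
  have hS' := Ico_subset_closure_interior hT
  have h0 : (0 : ℝ) ∈ Ico 0 T := ⟨le_rfl, hT⟩
  have hUnn : ∀ j, ∀ s ∈ Ico 0 T, ∀ z : M, 0 ≤ curvDerivNormSq (𝓡 4) g j s z := fun j s hs z ↦
    curvDerivNormSq_nonneg (hR s hs) j z
  have hS0 : 0 ≤ S := zero_le_one.trans hS1
  -- the evolution inequalities for `U_{n+1}` and `U_{n+2}`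
  obtain ⟨C₁, hC₁0, hev₁⟩ := hflow.derivWithin_curvDerivNormSq_le hS hS' hR h0 (n + 1)
  obtain ⟨C₂, hC₂0, hev₂⟩ := hflow.derivWithin_curvDerivNormSq_le hS hS' hR h0 (n + 1 + 1)
  -- `D₁ ≥ 1` and the late time `tst`
  obtain ⟨D₁, hD₁1, hDD₁⟩ : ∃ D₁ : ℝ, 1 ≤ D₁ ∧ D ≤ D₁ := ⟨max D 1, le_max_right _ _, le_max_left _ _⟩
  have hD₁0 : 0 ≤ D₁ := zero_le_one.trans hD₁1
  obtain ⟨tst, htst0, htstS, htstD, htst2⟩ :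
      ∃ tst : ℝ, tst ∈ Ico 0 T ∧ tS ≤ tst ∧ tD ≤ tst ∧ T - tst ≤ 1 / 2 :=
    ⟨max (max tS tD) (T - 1 / 2), ⟨le_max_of_le_left (le_max_of_le_left htS.1),
      max_lt (max_lt htS.2 htD.2) (by linarith)⟩, le_max_of_le_left (le_max_left _ _),
      le_max_of_le_left (le_max_right _ _), by linarith [le_max_right (max tS tD) (T - 1 / 2)]⟩
  have hlate : ∀ s ∈ Ico tst T, s ∈ Ico 0 T ∧
      (∀ p ≤ n + 1 + 1, ∀ x : M, curvDerivNormSq (𝓡 4) g p s x ≤ S * (T - s) ^ (-(p : ℝ) - 2)) ∧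
      (∀ j ≤ n, ∀ x : M, curvDerivNormSq (𝓡 4) g (j + 1) s x ≤ D₁ * (T - s) ^ (δ - j - 3)) :=
    fun s hs ↦ ⟨⟨htst0.1.trans hs.1, hs.2⟩, fun p hp x ↦ hShi p hp s ⟨htstS.trans hs.1, hs.2⟩ x,
      fun j hj x ↦ (hDec j hj s ⟨htstD.trans hs.1, hs.2⟩ x).trans
        (mul_le_mul_of_nonneg_right hDD₁ (Real.rpow_nonneg (sub_pos.2 hs.2).le _))⟩
  -- the reaction terms and their bounds at late times
  obtain ⟨Φf, hΦf⟩ : ∃ Φf : ℝ → M → ℝ, Φf = fun s y ↦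
      C₁ * (∑ p ∈ Finset.range (n + 1 + 1), Real.sqrt (curvDerivNormSq (𝓡 4) g p s y) *
        Real.sqrt (curvDerivNormSq (𝓡 4) g (n + 1 - p) s y)) *
        Real.sqrt (curvDerivNormSq (𝓡 4) g (n + 1) s y) +
        C₁ * Real.sqrt (curvDerivNormSq (𝓡 4) g 0 s y) * curvDerivNormSq (𝓡 4) g (n + 1) s y :=
    ⟨_, rfl⟩
  obtain ⟨ΦF, hΦF⟩ : ∃ ΦF : ℝ → M → ℝ, ΦF = fun s y ↦
      -2 * curvDerivNormSq (𝓡 4) g (n + 1 + 1 + 1) s y +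
      C₂ * (∑ p ∈ Finset.range (n + 1 + 1 + 1), Real.sqrt (curvDerivNormSq (𝓡 4) g p s y) *
        Real.sqrt (curvDerivNormSq (𝓡 4) g (n + 1 + 1 - p) s y)) *
        Real.sqrt (curvDerivNormSq (𝓡 4) g (n + 1 + 1) s y) +
        C₂ * Real.sqrt (curvDerivNormSq (𝓡 4) g 0 s y) * curvDerivNormSq (𝓡 4) g (n + 1 + 1) s y :=
    ⟨_, rfl⟩
  obtain ⟨Af, hAf0, hAf⟩ : ∃ Af : ℝ, 0 ≤ Af ∧ ∀ s ∈ Ico tst T, ∀ y : M,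
      Φf s y ≤ Af * (T - s) ^ (δ / 2 - n - 4) := by
    refine ⟨C₁ * ((n + 2) * S ^ 2 * D₁ + S * D₁), by positivity, fun s hs y ↦ ?_⟩
    obtain ⟨hs0, hSb, hDb⟩ := hlate s hs
    rw [hΦf]
    exact decayAll_phi_f_bound (u := fun p ↦ curvDerivNormSq (𝓡 4) g p s y) (sub_pos.2 hs.2)
      (by linarith [hs.1]) hS1 hD₁1 hδ (fun p ↦ hUnn p s hs0 y) (fun p hp ↦ hSb p hp y)
      (fun j hj ↦ hDb j hj y) hC₁0
  obtain ⟨BF, hBF0, hBF⟩ : ∃ BF : ℝ, 0 ≤ BF ∧ ∀ s ∈ Ico tst T, ∀ y : M, ΦF s y ≤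
      3 * C₂ * S * ((T - s) ^ (-1 : ℝ) * curvDerivNormSq (𝓡 4) g (n + 1 + 1) s y) +
        BF * (T - s) ^ (δ / 2 - n - 5) := by
    refine ⟨C₂ * ((n + 1) * D₁ * S ^ 2), by positivity, fun s hs y ↦ ?_⟩
    obtain ⟨hs0, hSb, hDb⟩ := hlate s hs
    rw [hΦF]
    exact decayAll_phi_F_bound (u := fun p ↦ curvDerivNormSq (𝓡 4) g p s y) (sub_pos.2 hs.2)
      hS1 hD₁1 (fun p ↦ hUnn p s hs0 y) (fun p hp ↦ hSb p hp y) (fun j hj ↦ hDb j hj y) hC₂0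
  -- the window lemma for `f = U_{n+1}`, `F = U_{n+2}`, `θ = 2`
  have hWf := hW 2 (curvDerivNormSq (𝓡 4) g (n + 1)) (curvDerivNormSq (𝓡 4) g (n + 1 + 1)) Φf ΦF
    two_pos (hflow.contMDiffOn_curvDerivNormSq hS hS' hR (n + 1))
    (hflow.contMDiffOn_curvDerivNormSq hS hS' hR (n + 1 + 1))
    (fun s hs y ↦ hUnn _ s hs y) (fun s hs y ↦ hUnn _ s hs y)
    (fun s hs y ↦ by simp only [hΦf]; linarith [hev₁ s hs y])
    (fun s hs y ↦ by simp only [hΦF]; linarith [hev₂ s hs y])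
  -- the window fraction `κ`, the factor `P`, the output
  obtain ⟨κ, hκ0, hκ2, hκK⟩ : ∃ κ : ℝ, 0 < κ ∧ κ ≤ 1 / 2 ∧ 6 * C₂ * S * κ ≤ 1 := by
    refine ⟨min (1 / 2) (1 / (6 * C₂ * S + 1)), lt_min (by norm_num) (by positivity),
      min_le_left _ _, ?_⟩
    have h1 : min (1 / 2) (1 / (6 * C₂ * S + 1)) ≤ 1 / (6 * C₂ * S + 1) := min_le_right _ _
    rw [le_div_iff₀ (by positivity)] at h1
    nlinarith [mul_nonneg (mul_nonneg (by norm_num : (0 : ℝ) ≤ 6) hC₂0) hS0,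
      le_min (by norm_num : (0 : ℝ) ≤ 1 / 2) (by positivity : (0 : ℝ) ≤ 1 / (6 * C₂ * S + 1))]
  obtain ⟨P, hPf, hPF⟩ : ∃ P : ℝ, (2 : ℝ) ^ |δ / 2 - n - 4| ≤ P ∧ (2 : ℝ) ^ |δ / 2 - n - 5| ≤ P :=
    ⟨max (2 ^ |δ / 2 - n - 4|) (2 ^ |δ / 2 - n - 5|), le_max_left _ _, le_max_right _ _⟩
  have hP0 : 0 ≤ P := (Real.rpow_nonneg zero_le_two _).trans hPf
  refine ⟨(D₁ * κ⁻¹ + κ * (BF * P) + Af * P) * P, (T + tst) / 2,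
    ⟨by linarith [htst0.1], by linarith [htst0.2]⟩, fun t ht x ↦ ?_⟩
  -- the window `[t₁, t]`: `T − t₁ = h₁ = (T − t)/(1 − κ)`, `t = t₁ + κ h₁`
  have htT : t < T := ht.2
  have hh : 0 < T - t := sub_pos.2 htT
  have h1κ : 0 < 1 - κ := by linarith
  obtain ⟨h₁, hh₁def⟩ : ∃ h₁ : ℝ, h₁ = (T - t) / (1 - κ) := ⟨_, rfl⟩
  have hh₁ : 0 < h₁ := by rw [hh₁def]; exact div_pos hh h1κ
  have hκh₁ : (1 - κ) * h₁ = T - t := by rw [hh₁def]; field_simp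
  have hhh₁ : T - t ≤ h₁ := by nlinarith [mul_nonneg hκ0.le hh₁.le]
  have hh₁2 : h₁ ≤ 2 * (T - t) := by nlinarith [mul_le_mul_of_nonneg_right hκ2 hh₁.le]
  have hh₁1 : h₁ ≤ 1 := by linarith [ht.1]
  obtain ⟨t₁, ht₁def⟩ : ∃ t₁ : ℝ, t₁ = T - h₁ := ⟨_, rfl⟩
  have hTt₁ : T - t₁ = h₁ := by rw [ht₁def]; ring
  have ht₁τ : t₁ + κ * h₁ = t := by rw [ht₁def]; linarith
  have ht₁tst : tst ≤ t₁ := by rw [ht₁def]; linarith [ht.1]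
  have ht₁T : t₁ < T := by rw [ht₁def]; linarith
  have hwin : ∀ s ∈ Icc t₁ (t₁ + κ * h₁), s ∈ Ico tst T ∧ h₁ / 2 ≤ T - s ∧ T - s ≤ 2 * h₁ := by
    intro s hs
    refine ⟨⟨ht₁tst.trans hs.1, by linarith [hs.2]⟩, ?_, by linarith [hs.1]⟩
    nlinarith [hs.2, mul_le_mul_of_nonneg_right hκ2 hh₁.le]
  -- the hypotheses of the window lemma on `[t₁, t₁ + κ h₁]`
  have hKτ : 6 * C₂ * S / h₁ * (κ * h₁) ≤ 1 := by
    calc 6 * C₂ * S / h₁ * (κ * h₁) = 6 * C₂ * S * κ * (h₁ / h₁) := by ring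
      _ ≤ 1 := by rw [div_self hh₁.ne', mul_one]; exact hκK
  have hA₀ : ∀ y : M, curvDerivNormSq (𝓡 4) g (n + 1) t₁ y ≤ D₁ * h₁ ^ (δ - n - 3) := by
    intro y
    have h := (hlate t₁ ⟨ht₁tst, ht₁T⟩).2.2 n le_rfl y
    rwa [hTt₁] at h
  have ha : ∀ s ∈ Icc t₁ (t₁ + κ * h₁), ∀ y : M, Φf s y ≤ Af * P * h₁ ^ (δ / 2 - n - 4) := by
    intro s hs y
    obtain ⟨hs', hlo, hhi⟩ := hwin s hs
    calc Φf s y ≤ Af * (T - s) ^ (δ / 2 - n - 4) := hAf s hs' y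
      _ ≤ Af * (P * h₁ ^ (δ / 2 - n - 4)) :=
        mul_le_mul_of_nonneg_left (decayAll_rpow_window_le _ hh₁ hlo hhi hPf) hAf0
      _ = Af * P * h₁ ^ (δ / 2 - n - 4) := by ring
  have hb : ∀ s ∈ Icc t₁ (t₁ + κ * h₁), ∀ y : M, ΦF s y ≤
      6 * C₂ * S / h₁ * curvDerivNormSq (𝓡 4) g (n + 1 + 1) s y + BF * P * h₁ ^ (δ / 2 - n - 5) := by
    intro s hs y
    obtain ⟨hs', hlo, hhi⟩ := hwin s hs
    have hu := hUnn (n + 1 + 1) s (hlate s hs').1 y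
    have hinv : (T - s) ^ (-1 : ℝ) ≤ 2 / h₁ := by
      calc (T - s) ^ (-1 : ℝ) = (T - s)⁻¹ := Real.rpow_neg_one _
        _ ≤ (h₁ / 2)⁻¹ := inv_anti₀ (by positivity) hlo
        _ = 2 / h₁ := inv_div _ _
    calc ΦF s y ≤ _ := hBF s hs' y
      _ ≤ 3 * C₂ * S * (2 / h₁ * curvDerivNormSq (𝓡 4) g (n + 1 + 1) s y) +
          BF * (P * h₁ ^ (δ / 2 - n - 5)) :=
        add_le_add (mul_le_mul_of_nonneg_left (mul_le_mul_of_nonneg_right hinv hu) (by positivity))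
          (mul_le_mul_of_nonneg_left (decayAll_rpow_window_le _ hh₁ hlo hhi hPF) hBF0)
      _ = _ := by ring
  -- the window lemma at `t = t₁ + κ h₁` and the arithmetic
  have key := hWf t₁ (κ * h₁) (6 * C₂ * S / h₁) (Af * P * h₁ ^ (δ / 2 - n - 4))
    (BF * P * h₁ ^ (δ / 2 - n - 5)) (D₁ * h₁ ^ (δ - n - 3)) ⟨htst0.1.trans ht₁tst, ht₁T⟩
    (mul_pos hκ0 hh₁) (by rw [ht₁τ]; exact htT) (by positivity) (by positivity) (by positivity)
    hKτ hA₀ ha hb t ⟨by nlinarith [mul_pos hκ0 hh₁], ht₁τ.ge⟩ x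
  rw [show t - t₁ = κ * h₁ by linarith] at key
  exact decayAll_window_arith (d := δ - n - 4) hκ0 hh hhh₁ hh₁2 hh₁1 hD₁0 hBF0 hAf0 hPf (by ring)
    (by ring) (by linarith) key

end Summit.SmoothPoincare4.SmoothPoincare4.Theorems.MargerinRails

end
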